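import Literature.NumberTheory.LFunctions.WeilTwoPrimeOddMarginKBase
import Literature.NumberTheory.LFunctions.WeilBlockRowsPZ
import HarnessLib

/-!
# Two-prime odd-margin certificate K: the Bessel block claim `Hp = C H Cᵀ`, rows 0–4

`WeilCert.checkHpRow` for certificate K (the exact Legendre cancellation `C H Cᵀ = diag(2a₀/(4i+3))`), by `decide +kernel`. Pure proof file.
-/

noncomputable section

namespace Literature.NumberTheory.LFunctions

set_option maxHeartbeats 0 in
/-- Row 0 of `C H Cᵀ` is row 0 of `Hp` (certificate K). [folklore] -/
theorem checkHpRow1_0_weilCert23K : weilCert23KBase.checkHpRow weilCert23KHp 1 0 = true := by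
  decide +kernel

set_option maxHeartbeats 0 in
/-- Row 1 of `C H Cᵀ` is row 1 of `Hp` (certificate K). [folklore] -/
theorem checkHpRow1_1_weilCert23K : weilCert23KBase.checkHpRow weilCert23KHp 1 1 = true := by
  decide +kernel

set_option maxHeartbeats 0 in
/-- Row 2 of `C H Cᵀ` is row 2 of `Hp` (certificate K). [folklore] -/
theorem checkHpRow1_2_weilCert23K : weilCert23KBase.checkHpRow weilCert23KHp 1 2 = true := by
  decide +kernel

set_option maxHeartbeats 0 in
/-- Row 3 of `C H Cᵀ` is row 3 of `Hp` (certificate K). [folklore] -/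
theorem checkHpRow1_3_weilCert23K : weilCert23KBase.checkHpRow weilCert23KHp 1 3 = true := by
  decide +kernel

set_option maxHeartbeats 0 in
/-- Row 4 of `C H Cᵀ` is row 4 of `Hp` (certificate K). [folklore] -/
theorem checkHpRow1_4_weilCert23K : weilCert23KBase.checkHpRow weilCert23KHp 1 4 = true := by
  decide +kernel


end Literature.NumberTheory.LFunctions
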